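import Literature.Topology.FourManifolds.KhAntiBigonHomotopy
import Literature.Topology.FourManifolds.KhBigonRotate
import HarnessLib

/-!
# Invariance of Khovanov homology under the anti-parallel second Reidemeister move (`Ω2c/Ω2d`)

Sibling file of `KhBigonRotate.lean`, assembling `KhAntiBigonHomotopy` (the anti-parallel bigon
in normal position) and `KhComplexTransportProofs` (independence of the base point) into the
invariance of Khovanov homology under the move `RMove.omega2c G o u o' u' ε` of
`GaussDiagramsRMoves.lean` at general positions (Polyak (2010), Fig. 2, `Ω2c, Ω2d`):

* `omega2c_params` — the adjacency hypotheses of `RMove.omega2c` pin the second insertion: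
  `u' = xu` and `o' = xo + 1 + [xu < xo]`, where `xo, xu` are the over- and under-passage of the
  first new chord in the intermediate diagram (compare `omega2a_params`: `u' = xu + 1`);
* `insertChord_insertChord_eq_rotate_antiBigon` — **the target of `Ω2c` is a rotated
  anti-parallel bigon**:
  `(G.insertChord o u ε).insertChord o' u' (-ε) = ((G.rotate (2n - u)).antiBigon m ε).rotate r'`
  with the middle position `m = omega2aM o u` and the rotation `r' = omega2aR' o u` of the
  co-oriented case (the old points and the first new chord sit where they sit for `Ω2a`);
* `nonempty_iso_khovanovHomology_omega2c` —
  **`Kh^{i,j}((G.insertChord o u ε).insertChord o' u' (-ε)) ≅ Kh^{i,j}(G)`** whenever every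
  edge of the cube of the target is a merge or a split (in particular when the target is the
  diagram of a knot, `…_of_hasGaussDiagram`), and the same over the universal Frobenius system
  (`nonempty_iso_frobeniusHomology_omega2c`).

Khovanov (2000), §5.3, Thm. 1; Bar-Natan (2002), §4.3; Polyak (2010), Thm. 1.2. No named fact is
introduced.

## References

* M. Khovanov, *A categorification of the Jones polynomial*, Duke Math. J. 101 (2000) 359–426,
  §5.3, Thm. 1. [cite: Khovanov2000, Thm. 1]
* D. Bar-Natan, *On Khovanov's categorification of the Jones polynomial*, Algebr. Geom. Topol. 2
  (2002) 337–370, §4.3. [cite: BarNatan2002, §4]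
* M. Polyak, *Minimal generating sets of Reidemeister moves*, Quantum Topol. 1 (2010), Thm. 1.2,
  Fig. 2. [cite: Polyak2010, Thm 1.2]
-/

open Function

noncomputable section

namespace Literature.Topology.FourManifolds

namespace GaussDiagram

variable (G : GaussDiagram) (o : Fin (2 * G.n + 2)) (u : Fin (2 * G.n + 1))
  (o' : Fin (2 * (G.n + 1) + 2)) (u' : Fin (2 * (G.n + 1) + 1)) (ε : ℤˣ)

/-! ## The parameters of `Ω2c` -/

/-- **The adjacency hypotheses of `Ω2c` pin the second insertion.** With `xo = o` and
`xu = o.succAbove u` the passages of the first new chord in the intermediate diagram, the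
over-passages of the two new chords are adjacent (`x` first) and their under-passages are adjacent
in the opposite order (`y` first) iff `u' = xu` and `o' = xo + 2` (`xu < xo`) or `o' = xo + 1`
(`xo < xu`). [folklore] -/
theorem omega2c_params
    (hover : (((G.insertChord o u ε).insertChord o' u' (-ε)).overPos (Fin.last (G.n + 1)) : ℕ) =
      ((G.insertChord o u ε).insertChord o' u' (-ε)).overPos (Fin.last G.n).castSucc + 1)
    (hunder : (((G.insertChord o u ε).insertChord o' u' (-ε)).underPos (Fin.last G.n).castSucc : ℕ) =
      ((G.insertChord o u ε).insertChord o' u' (-ε)).underPos (Fin.last (G.n + 1)) + 1) :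
    u'.val = (o.succAbove u).val ∧
      o'.val = (if (o.succAbove u).val < o.val then o.val + 2 else o.val + 1) := by
  have e1 : ((G.insertChord o u ε).insertChord o' u' (-ε)).overPos (Fin.last (G.n + 1)) = o' := insertChord_overPos_last _ _ _ _
  have e2 : ((G.insertChord o u ε).insertChord o' u' (-ε)).overPos (Fin.last G.n).castSucc =
      (G.insertChord o u ε).insEmb o' u' ((G.insertChord o u ε).overPos (Fin.last G.n)) := insertChord_overPos_castSucc_eq _ _ _ _ _
  have e3 : ((G.insertChord o u ε).insertChord o' u' (-ε)).underPos (Fin.last (G.n + 1)) = o'.succAbove u' := insertChord_underPos_last _ _ _ _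
  have e4 : ((G.insertChord o u ε).insertChord o' u' (-ε)).underPos (Fin.last G.n).castSucc =
      (G.insertChord o u ε).insEmb o' u' ((G.insertChord o u ε).underPos (Fin.last G.n)) := insertChord_underPos_castSucc_eq _ _ _ _ _
  rw [e1, e2, val_insEmb, insertChord_overPos_last] at hover
  rw [e3, e4, val_insEmb, insertChord_underPos_last, val_succAbove] at hunder
  have h1 := o.isLt; have h2 := u.isLt; have h3 := o'.isLt; have h4 := u'.isLt
  have h5 : (o.succAbove u).val ≠ o.val := fun h ↦ Fin.succAbove_ne o u (Fin.ext h)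
  rw [val_succAbove] at hunder h5 ⊢
  split_ifs at hover hunder h5 ⊢ <;> omega

/-! ## The target of `Ω2c` is a rotated anti-parallel bigon

The middle position `omega2aM o u` and the rotation `omega2aR' o u` are those of `KhBigonRotate`
(they only depend on the first insertion). -/


section Conjugate

variable {o u o' u'}
variable (hu' : u'.val = (o.succAbove u).val)
  (ho' : o'.val = (if (o.succAbove u).val < o.val then o.val + 2 else o.val + 1))

include hu' ho' in
-- a case analysis over the relative positions of an old point and the four new ones
set_option maxHeartbeats 1600000 in
/-- The over-passage of an old chord: target of `Ω2c` versus rotated anti-parallel bigon. [folklore] -/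
theorem val_overPos_omega2c_old (i : Fin G.n) :
    (((G.insertChord o u ε).insertChord o' u' (-ε)).overPos i.castSucc.castSucc : ℕ) =
      (((G.rotate (2 * G.n - u.val)).antiBigon (G.omega2aM o u) ε).rotate (G.omega2aR' o u)).overPos
        ((G.rotate (2 * G.n - u.val)).oldC' (G.omega2aM o u) ε i) := by
  have h1 := o.isLt; have h2 := u.isLt; have hq := (G.overPos i).isLt
  have h5 : (o.succAbove u).val ≠ o.val := fun h ↦ Fin.succAbove_ne o u (Fin.ext h)
  have e1 : ((G.insertChord o u ε).insertChord o' u' (-ε)).overPos i.castSucc.castSucc = (G.insertChord o u ε).insEmb o' u' ((G.insertChord o u ε).overPos i.castSucc) :=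
    insertChord_overPos_castSucc_eq _ _ _ _ _
  have e2 : (G.insertChord o u ε).overPos i.castSucc = G.insEmb o u (G.overPos i) :=
    insertChord_overPos_castSucc_eq _ _ _ _ _
  rw [e1, val_insEmb, e2, val_insEmb, val_rotate_overPos]
  show _ = (((G.rotate (2 * G.n - u.val)).antiBigon (G.omega2aM o u) ε).overPos
    ((G.rotate (2 * G.n - u.val)).oldC' (G.omega2aM o u) ε i) + G.omega2aR' o u) % (2 * (G.n + 2))
  rw [val_overPos_antiBigon_oldC, val_rotate_overPos, val_omega2aM, hu', ho']
  unfold omega2aR'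
  rw [val_succAbove] at h5 ⊢
  rw [mod_eq_ite_of_lt (k := 2 * G.n), mod_eq_ite_of_lt (k := 2 * (G.n + 2))]
  · by_cases hlt : u.val < o.val
    · simp only [if_pos hlt]
      split_ifs <;> omega
    · simp only [if_neg hlt]
      split_ifs <;> omega
  · by_cases hlt : u.val < o.val
    · simp only [if_pos hlt]
      split_ifs <;> omega
    · simp only [if_neg hlt]
      split_ifs <;> omega
  · omega

include hu' ho' in
-- a case analysis over the relative positions of an old point and the four new ones
set_option maxHeartbeats 1600000 in
/-- The under-passage of an old chord: target of `Ω2c` versus rotated anti-parallel bigon. [folklore] -/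
theorem val_underPos_omega2c_old (i : Fin G.n) :
    (((G.insertChord o u ε).insertChord o' u' (-ε)).underPos i.castSucc.castSucc : ℕ) =
      (((G.rotate (2 * G.n - u.val)).antiBigon (G.omega2aM o u) ε).rotate (G.omega2aR' o u)).underPos
        ((G.rotate (2 * G.n - u.val)).oldC' (G.omega2aM o u) ε i) := by
  have h1 := o.isLt; have h2 := u.isLt; have hq := (G.underPos i).isLt
  have h5 : (o.succAbove u).val ≠ o.val := fun h ↦ Fin.succAbove_ne o u (Fin.ext h)
  have e1 : ((G.insertChord o u ε).insertChord o' u' (-ε)).underPos i.castSucc.castSucc = (G.insertChord o u ε).insEmb o' u' ((G.insertChord o u ε).underPos i.castSucc) :=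
    insertChord_underPos_castSucc_eq _ _ _ _ _
  have e2 : (G.insertChord o u ε).underPos i.castSucc = G.insEmb o u (G.underPos i) :=
    insertChord_underPos_castSucc_eq _ _ _ _ _
  rw [e1, val_insEmb, e2, val_insEmb, val_rotate_underPos]
  show _ = (((G.rotate (2 * G.n - u.val)).antiBigon (G.omega2aM o u) ε).underPos
    ((G.rotate (2 * G.n - u.val)).oldC' (G.omega2aM o u) ε i) + G.omega2aR' o u) % (2 * (G.n + 2))
  rw [val_underPos_antiBigon_oldC, val_rotate_underPos, val_omega2aM, hu', ho']
  unfold omega2aR'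
  rw [val_succAbove] at h5 ⊢
  rw [mod_eq_ite_of_lt (k := 2 * G.n), mod_eq_ite_of_lt (k := 2 * (G.n + 2))]
  · by_cases hlt : u.val < o.val
    · simp only [if_pos hlt]
      split_ifs <;> omega
    · simp only [if_neg hlt]
      split_ifs <;> omega
  · by_cases hlt : u.val < o.val
    · simp only [if_pos hlt]
      split_ifs <;> omega
    · simp only [if_neg hlt]
      split_ifs <;> omega
  · omega

include hu' ho' in
/-- The over-passage of the first new chord. [folklore] -/
theorem val_overPos_omega2c_bX :
    (((G.insertChord o u ε).insertChord o' u' (-ε)).overPos (Fin.last G.n).castSucc : ℕ) =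
      (((G.rotate (2 * G.n - u.val)).antiBigon (G.omega2aM o u) ε).rotate (G.omega2aR' o u)).overPos
        ((G.rotate (2 * G.n - u.val)).bX' (G.omega2aM o u) ε) := by
  have h1 := o.isLt; have h2 := u.isLt; have h3 := u'.isLt
  have h5 : (o.succAbove u).val ≠ o.val := fun h ↦ Fin.succAbove_ne o u (Fin.ext h)
  have e1 : ((G.insertChord o u ε).insertChord o' u' (-ε)).overPos (Fin.last G.n).castSucc = (G.insertChord o u ε).insEmb o' u' ((G.insertChord o u ε).overPos (Fin.last G.n)) :=
    insertChord_overPos_castSucc_eq _ _ _ _ _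
  rw [e1, val_insEmb, insertChord_overPos_last, val_rotate_overPos]
  show _ = (((G.rotate (2 * G.n - u.val)).antiBigon (G.omega2aM o u) ε).overPos
    ((G.rotate (2 * G.n - u.val)).bX' (G.omega2aM o u) ε) + G.omega2aR' o u) % (2 * (G.n + 2))
  rw [val_overPos_antiBigon_bX, val_omega2aM, hu', ho']
  unfold omega2aR'
  rw [val_succAbove] at h5 ⊢
  rw [mod_eq_ite_of_lt (k := 2 * (G.n + 2))]
  · split_ifs <;> omega
  all_goals first | omega | (split_ifs <;> omega)

include hu' ho' in
/-- The under-passage of the first new chord. [folklore] -/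
theorem val_underPos_omega2c_bX :
    (((G.insertChord o u ε).insertChord o' u' (-ε)).underPos (Fin.last G.n).castSucc : ℕ) =
      (((G.rotate (2 * G.n - u.val)).antiBigon (G.omega2aM o u) ε).rotate (G.omega2aR' o u)).underPos
        ((G.rotate (2 * G.n - u.val)).bX' (G.omega2aM o u) ε) := by
  have h1 := o.isLt; have h2 := u.isLt
  have h5 : (o.succAbove u).val ≠ o.val := fun h ↦ Fin.succAbove_ne o u (Fin.ext h)
  have e1 : ((G.insertChord o u ε).insertChord o' u' (-ε)).underPos (Fin.last G.n).castSucc = (G.insertChord o u ε).insEmb o' u' ((G.insertChord o u ε).underPos (Fin.last G.n)) :=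
    insertChord_underPos_castSucc_eq _ _ _ _ _
  rw [e1, val_insEmb, insertChord_underPos_last, val_rotate_underPos]
  show _ = (((G.rotate (2 * G.n - u.val)).antiBigon (G.omega2aM o u) ε).underPos
    ((G.rotate (2 * G.n - u.val)).bX' (G.omega2aM o u) ε) + G.omega2aR' o u) % (2 * (G.n + 2))
  rw [val_underPos_antiBigon_bX, hu', ho']
  unfold omega2aR'
  rw [val_succAbove] at h5 ⊢
  simp only [rotate_n]
  rw [mod_eq_ite_of_lt (k := 2 * (G.n + 2))]
  · split_ifs <;> omega
  all_goals first | omega | (split_ifs <;> omega)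

include ho' in
/-- The over-passage of the second new chord. [folklore] -/
theorem val_overPos_omega2c_bY :
    (((G.insertChord o u ε).insertChord o' u' (-ε)).overPos (Fin.last (G.n + 1)) : ℕ) =
      (((G.rotate (2 * G.n - u.val)).antiBigon (G.omega2aM o u) ε).rotate (G.omega2aR' o u)).overPos
        ((G.rotate (2 * G.n - u.val)).bY' (G.omega2aM o u) ε) := by
  have h1 := o.isLt; have h2 := u.isLt
  have h5 : (o.succAbove u).val ≠ o.val := fun h ↦ Fin.succAbove_ne o u (Fin.ext h)
  have e1 : ((G.insertChord o u ε).insertChord o' u' (-ε)).overPos (Fin.last (G.n + 1)) = o' := insertChord_overPos_last _ _ _ _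
  rw [e1, val_rotate_overPos]
  show _ = (((G.rotate (2 * G.n - u.val)).antiBigon (G.omega2aM o u) ε).overPos
    ((G.rotate (2 * G.n - u.val)).bY' (G.omega2aM o u) ε) + G.omega2aR' o u) % (2 * (G.n + 2))
  rw [val_overPos_antiBigon_bY, val_omega2aM, ho']
  unfold omega2aR'
  rw [val_succAbove] at h5 ⊢
  rw [mod_eq_ite_of_lt (k := 2 * (G.n + 2))]
  · split_ifs <;> omega
  all_goals first | omega | (split_ifs <;> omega)

include hu' ho' in
/-- The under-passage of the second new chord. [folklore] -/
theorem val_underPos_omega2c_bY :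
    (((G.insertChord o u ε).insertChord o' u' (-ε)).underPos (Fin.last (G.n + 1)) : ℕ) =
      (((G.rotate (2 * G.n - u.val)).antiBigon (G.omega2aM o u) ε).rotate (G.omega2aR' o u)).underPos
        ((G.rotate (2 * G.n - u.val)).bY' (G.omega2aM o u) ε) := by
  have h1 := o.isLt; have h2 := u.isLt; have h3 := o'.isLt
  have h5 : (o.succAbove u).val ≠ o.val := fun h ↦ Fin.succAbove_ne o u (Fin.ext h)
  have e1 : ((G.insertChord o u ε).insertChord o' u' (-ε)).underPos (Fin.last (G.n + 1)) = o'.succAbove u' := insertChord_underPos_last _ _ _ _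
  rw [e1, val_succAbove, val_rotate_underPos]
  show _ = (((G.rotate (2 * G.n - u.val)).antiBigon (G.omega2aM o u) ε).underPos
    ((G.rotate (2 * G.n - u.val)).bY' (G.omega2aM o u) ε) + G.omega2aR' o u) % (2 * (G.n + 2))
  rw [val_underPos_antiBigon_bY, hu', ho']
  unfold omega2aR'
  rw [val_succAbove] at h5 ⊢
  simp only [rotate_n]
  rw [mod_eq_ite_of_lt (k := 2 * (G.n + 2))]
  · split_ifs <;> omega
  all_goals first | omega | (split_ifs <;> omega)

end Conjugate

/-- **The target of `Ω2c` is a rotated anti-parallel bigon**: under the adjacency hypotheses of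
`RMove.omega2c G o u o' u' ε`, the diagram `(G.insertChord o u ε).insertChord o' u' (-ε)`
is the antiBigon in normal position (over-passages in the middle, under-passages at the end) of the
diagram rotated by `2n - u`, rotated back. GPV (2000), §1.2 (based Gauss diagrams); Polyak
(2010), §2. [cite: Polyak2010, §2] -/
theorem insertChord_insertChord_eq_rotate_antiBigon
    (hover : (((G.insertChord o u ε).insertChord o' u' (-ε)).overPos (Fin.last (G.n + 1)) : ℕ) =
      ((G.insertChord o u ε).insertChord o' u' (-ε)).overPos (Fin.last G.n).castSucc + 1)
    (hunder : (((G.insertChord o u ε).insertChord o' u' (-ε)).underPos (Fin.last G.n).castSucc : ℕ) =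
      ((G.insertChord o u ε).insertChord o' u' (-ε)).underPos (Fin.last (G.n + 1)) + 1) :
    (G.insertChord o u ε).insertChord o' u' (-ε) =
      ((G.rotate (2 * G.n - u.val)).antiBigon (G.omega2aM o u) ε).rotate (G.omega2aR' o u) := by
  obtain ⟨hu', ho'⟩ := G.omega2c_params o u o' u' ε hover hunder
  refine ext_of_val rfl (fun i j hij ↦ ?_) (fun i j hij ↦ ?_) (fun i j hij ↦ ?_)
  · rcases (G.rotate (2 * G.n - u.val)).eq_oldC_or_bX_or_bY' (G.omega2aM o u) ε j with
      ⟨i₀, rfl⟩ | rfl | rfl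
    · obtain rfl : i = i₀.castSucc.castSucc := Fin.ext hij
      exact G.val_overPos_omega2c_old ε hu' ho' i₀
    · obtain rfl : i = (Fin.last G.n).castSucc := Fin.ext hij
      exact G.val_overPos_omega2c_bX ε hu' ho'
    · obtain rfl : i = Fin.last (G.n + 1) := Fin.ext hij
      exact G.val_overPos_omega2c_bY ε ho'
  · rcases (G.rotate (2 * G.n - u.val)).eq_oldC_or_bX_or_bY' (G.omega2aM o u) ε j with
      ⟨i₀, rfl⟩ | rfl | rfl
    · obtain rfl : i = i₀.castSucc.castSucc := Fin.ext hij
      exact G.val_underPos_omega2c_old ε hu' ho' i₀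
    · obtain rfl : i = (Fin.last G.n).castSucc := Fin.ext hij
      exact G.val_underPos_omega2c_bX ε hu' ho'
    · obtain rfl : i = Fin.last (G.n + 1) := Fin.ext hij
      exact G.val_underPos_omega2c_bY ε hu' ho'
  · rcases (G.rotate (2 * G.n - u.val)).eq_oldC_or_bX_or_bY' (G.omega2aM o u) ε j with
      ⟨i₀, rfl⟩ | rfl | rfl
    · obtain rfl : i = i₀.castSucc.castSucc := Fin.ext hij
      have e : ((G.insertChord o u ε).insertChord o' u' (-ε)).sign i₀.castSucc.castSucc = G.sign i₀ :=
        ((G.insertChord o u ε).insertChord_sign_castSucc _ _ _ i₀.castSucc).trans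
          (G.insertChord_sign_castSucc _ _ _ i₀)
      exact e.trans ((G.rotate (2 * G.n - u.val)).sign_antiBigon_oldC (G.omega2aM o u) ε i₀).symm
    · obtain rfl : i = (Fin.last G.n).castSucc := Fin.ext hij
      have e : ((G.insertChord o u ε).insertChord o' u' (-ε)).sign (Fin.last G.n).castSucc = ε :=
        ((G.insertChord o u ε).insertChord_sign_castSucc _ _ _ (Fin.last G.n)).trans
          (G.insertChord_sign_last _ _ _)
      exact e.trans ((G.rotate (2 * G.n - u.val)).sign_antiBigon_bX (G.omega2aM o u) ε).symm
    · obtain rfl : i = Fin.last (G.n + 1) := Fin.ext hij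
      have e : ((G.insertChord o u ε).insertChord o' u' (-ε)).sign (Fin.last (G.n + 1)) = -ε :=
        (G.insertChord o u ε).insertChord_sign_last _ _ _
      exact e.trans ((G.rotate (2 * G.n - u.val)).sign_antiBigon_bY (G.omega2aM o u) ε).symm

/-! ## The second Reidemeister move -/

section Omega2c

variable
  (hover : (((G.insertChord o u ε).insertChord o' u' (-ε)).overPos (Fin.last (G.n + 1)) : ℕ) =
    ((G.insertChord o u ε).insertChord o' u' (-ε)).overPos (Fin.last G.n).castSucc + 1)
  (hunder : (((G.insertChord o u ε).insertChord o' u' (-ε)).underPos (Fin.last G.n).castSucc : ℕ) =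
    ((G.insertChord o u ε).insertChord o' u' (-ε)).underPos (Fin.last (G.n + 1)) + 1)
  (hms : ∀ (τ : ((G.insertChord o u ε).insertChord o' u' (-ε)).State)
    (j : Fin ((G.insertChord o u ε).insertChord o' u' (-ε)).n), τ j = false →
    ((G.insertChord o u ε).insertChord o' u' (-ε)).IsMergeAt τ j ∨
      ((G.insertChord o u ε).insertChord o' u' (-ε)).IsSplitAt τ j)

include hover hunder hms in
/-- **Integral Khovanov homology is invariant under `Ω2c`**: for every Gauss diagram `G` and
every instance of `RMove.omega2c G o u o' u' ε` all of whose cube edges are merges or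
splits, `Kh^{i,j}((G.insertChord o u ε).insertChord o' u' (-ε)) ≅ Kh^{i,j}(G)` (stated from the
target to the source). Khovanov (2000), §5.3, Thm. 1; Bar-Natan (2002), §4.3; Polyak (2010), Fig. 2.
[cite: Khovanov2000, Thm. 1] -/
theorem nonempty_iso_khovanovHomology_omega2c (i j : ℤ) :
    Nonempty (((G.insertChord o u ε).insertChord o' u' (-ε)).khovanovHomology i j ≅
      G.khovanovHomology i j) := by
  rw [G.insertChord_insertChord_eq_rotate_antiBigon o u o' u' ε hover hunder] at hms ⊢
  obtain ⟨e₁⟩ := G.nonempty_iso_khovanovHomology_rotate (2 * G.n - u.val) i j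
  obtain ⟨e₂⟩ := (G.rotate (2 * G.n - u.val)).nonempty_iso_khovanovHomology_antiBigon (G.omega2aM o u)
    ε (dichotomy_of_rotate _ _ hms) i j
  obtain ⟨e₃⟩ := ((G.rotate (2 * G.n - u.val)).antiBigon (G.omega2aM o u) ε).nonempty_iso_khovanovHomology_rotate
    (G.omega2aR' o u) i j
  exact ⟨(e₁ ≪≫ e₂ ≪≫ e₃).symm⟩

include hover hunder hms in
/-- **The homology over the universal Frobenius system is invariant under `Ω2c`**, every
`(R, h, t)`, for instances all of whose cube edges are merges or splits. Khovanov (2000), §5.3;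
Khovanov (2006). [cite: Khovanov2000, Thm. 1] -/
theorem nonempty_iso_frobeniusHomology_omega2c {R : Type} [CommRing R] (hR tR : R) (i : ℤ) :
    Nonempty (((G.insertChord o u ε).insertChord o' u' (-ε)).frobeniusHomology R hR tR i ≅
      G.frobeniusHomology R hR tR i) := by
  rw [G.insertChord_insertChord_eq_rotate_antiBigon o u o' u' ε hover hunder] at hms ⊢
  obtain ⟨e₁⟩ := G.nonempty_iso_frobeniusHomology_rotate hR tR (2 * G.n - u.val) i
  obtain ⟨e₂⟩ := (G.rotate (2 * G.n - u.val)).nonempty_iso_frobeniusHomology_antiBigon (G.omega2aM o u)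
    ε hR tR (dichotomy_of_rotate _ _ hms) i
  obtain ⟨e₃⟩ := ((G.rotate (2 * G.n - u.val)).antiBigon (G.omega2aM o u) ε).nonempty_iso_frobeniusHomology_rotate
    hR tR (G.omega2aR' o u) i
  exact ⟨(e₁ ≪≫ e₂ ≪≫ e₃).symm⟩

end Omega2c

/-- **Integral Khovanov homology is invariant under `Ω2c` for targets realised by a knot.**
[cite: Khovanov2000, Thm. 1] -/
theorem nonempty_iso_khovanovHomology_omega2c_of_hasGaussDiagram
    (hover : (((G.insertChord o u ε).insertChord o' u' (-ε)).overPos (Fin.last (G.n + 1)) : ℕ) =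
      ((G.insertChord o u ε).insertChord o' u' (-ε)).overPos (Fin.last G.n).castSucc + 1)
    (hunder : (((G.insertChord o u ε).insertChord o' u' (-ε)).underPos (Fin.last G.n).castSucc : ℕ) =
      ((G.insertChord o u ε).insertChord o' u' (-ε)).underPos (Fin.last (G.n + 1)) + 1)
    (hK : ∃ K : Knot, K.HasGaussDiagram ((G.insertChord o u ε).insertChord o' u' (-ε))) (i j : ℤ) :
    Nonempty (((G.insertChord o u ε).insertChord o' u' (-ε)).khovanovHomology i j ≅
      G.khovanovHomology i j) :=
  G.nonempty_iso_khovanovHomology_omega2c o u o' u' ε hover hunder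
    (fun _ _ hτ ↦ isMergeAt_or_isSplitAt_of_hasGaussDiagram_holds hK hτ) i j

end GaussDiagram

end Literature.Topology.FourManifolds
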